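import Mathlib
import Literature.NumberTheory.LFunctions.Zhang2022.AppendixALemma83CaseOne
import Literature.NumberTheory.LFunctions.Zhang2022.AppendixALemma83ClosedForms
import Literature.NumberTheory.LFunctions.Zhang2022.Section8PerronSteps
import HarnessLib

/-!
# Zhang (2022), Appendix A part 1 (proof of Lemma 8.3): the generic-prime local estimates —
# Z22:§A.u006 (instance used) and "`𝔱_j(d,h,s;q) = 1 + O(q^{−9/5})` for `σ > 9/10`" (Z22:§A.u007,
# local clause) — kernel-checked

Topic `Literature/NumberTheory/LFunctions/Zhang2022` (Landau–Siegel audit tree; verdict-neutral).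
Y. Zhang, *Discrete mean estimates and the Landau–Siegel zero*, arXiv:2211.02515v1 (2022)
[Zhang2022LandauSiegel], Appendix A p. 101 (tex L4993–L4999), **an unrefereed manuscript under
adjudication**. For a prime `q` with `(q,dh) = 1` (Case 1 of the printed proof) the inner sum of
`ξ₀ⱼ` is `ξ_j(q^n;d,h) = Σ_{i≥0} κ(q^{n+i})q^{−i(1−β_j)} − κ(q^{n−1})q^{1−β_j}/(q−1)`
(`AppendixALemma83Local`). Since the shifts `β₁, β₂, β₃` are PURELY IMAGINARY
(`Skeleton.beta1/2/3`), `|κ(q^m)| ≤ (m+1)³` uniformly in `q` (the tree's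
`MeanSquareMajorant.norm_kappa_prime_pow_le`) and `|q^{−(1−β_j)}| = q⁻¹`; this file PROVES, with
explicit absolute constants and for EVERY prime `q` (no `q < D`, no `(q,D) = 1`):

* `norm_xiA_prime_pow_le` — `‖ξ_j(q^n;d,h)‖ ≤ 258(n+1)³` (`n ≥ 1`);
* `norm_xiA_prime_sub_le` — `‖ξ_j(q;d,h) − (κ(q) − q^{−β_j})‖ ≤ 866/q`;
* `lamTilde_prime_eq`, `norm_lamTilde_prime_le`, `norm_lamTilde_prime_sub_one_le` — the single
  factor `λ̃(q,dh;1−β_j)`, `‖λ̃‖ ≤ 7`, `‖λ̃ − 1‖ ≤ 12/q`;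
* `kappaZ_prime_sub_cpow` — `κ(q) − q^{−β_j} = q^{−β_{j+1}} + q^{−β_{j+2}} − 1` (`j ∈ {1,2,3}`);
* `norm_lamTilde_mul_xiA_prime_sub_le` — `‖λ̃(q,dh;1−β_j)ξ_j(q;d,h) − (q^{−β_{j+1}} + q^{−β_{j+2}}
  − 1)‖ ≤ 6100/q`, whence **Z22:§A.u006 in the instance used holds**:
  `stepA_u006_used_holds : StepA_u006_used c′` (DAG `Z22:§A.u006`, tex L4993, flag F3 of
  `TypedAppendixA1`: the printed all-`(q,r)` display is false for `r ≥ 2`; the next sentence uses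
  exactly `r = 1`, `(q,dh) = 1`);
* `norm_frakt_sub_one_le` — for `σ > 9/10`: `‖𝔱_j(d,h,s;q) − 1‖ ≤ C·q^{−9/5}` (the first-order
  terms `χ(q)q^{−s}(1 − q^{−β_{j+1}} − q^{−β_{j+2}})` of the prefactor and
  `χ(q)q^{−s}(q^{−β_{j+1}} + q^{−β_{j+2}} − 1)` of the `r = 1` series term CANCEL; the remainder is
  `O(q^{−2σ} + q^{−1−σ})`), whence **the local clause of Z22:§A.u007 holds**:
  `stepA_u007_local_holds : StepA_u007_local c′` (tex L4999, "we have `𝔱_j = 1 + O(q^{−9/5})`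
  for `σ > 9/10`").

These are two of the five typed inputs of `Typed.AppendixA1.DedLem83_read` that were open at the
campaign's PHASE 1 (sz-d55 HANDOFF; gap rows G-L4t8-3, G-d55-1); the remaining three
(`StepA_u004_read`, `StepA_u007_analytic`, `StepA_u007_read`) are the global Euler-product steps.
Nothing here bears on Theorems 1–2 of the manuscript.

## References

* Y. Zhang, arXiv:2211.02515v1 (2022), Appendix A p. 101, tex L4988–L4999; §7 p. 33 (`κ`, `κ̃`,
  `λ̃`, `ξ₀ⱼ`). [cite: Zhang2022LandauSiegel, App. A]
-/

noncomputable section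

open Complex Real ComplexConjugate Finset

namespace Literature.NumberTheory.LFunctions.Zhang2022.Lemma83

open Literature.NumberTheory.LFunctions.Zhang2022
open Literature.NumberTheory.LFunctions.Zhang2022.Skeleton
open Literature.NumberTheory.LFunctions.Zhang2022.MeanSquareMajorant
open Literature.NumberTheory.LFunctions.Zhang2022.Typed.AppendixA1

/-! ## Private summation helpers (as in `AppendixALemma83CaseOne`) -/

/-- `(r+2)³ ≤ 64·(3/2)^r`. [folklore] -/
private theorem pow_three_le' (r : ℕ) : ((r : ℝ) + 2) ^ 3 ≤ 64 * (3 / 2 : ℝ) ^ r := by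
  have step : ∀ n : ℕ, 5 ≤ n → ((n : ℝ) + 2) ^ 3 ≤ 64 * (3 / 2 : ℝ) ^ n →
      (((n + 1 : ℕ) : ℝ) + 2) ^ 3 ≤ 64 * (3 / 2 : ℝ) ^ (n + 1) := by
    intro n hn ih
    have hn' : (5 : ℝ) ≤ n := by exact_mod_cast hn
    have key : ((n : ℝ) + 1 + 2) ^ 3 ≤ (3 / 2) * ((n : ℝ) + 2) ^ 3 := by
      have h1 : ((n : ℝ) + 3) ≤ (8 / 7) * ((n : ℝ) + 2) := by linarith
      have h2 : 0 ≤ (n : ℝ) + 3 := by linarith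
      calc ((n : ℝ) + 1 + 2) ^ 3 = ((n : ℝ) + 3) ^ 3 := by ring
        _ ≤ ((8 / 7) * ((n : ℝ) + 2)) ^ 3 := pow_le_pow_left₀ h2 h1 3
        _ = (8 / 7) ^ 3 * ((n : ℝ) + 2) ^ 3 := by ring
        _ ≤ (3 / 2) * ((n : ℝ) + 2) ^ 3 := by
            apply mul_le_mul_of_nonneg_right (by norm_num) (by positivity)
    calc (((n + 1 : ℕ) : ℝ) + 2) ^ 3 = ((n : ℝ) + 1 + 2) ^ 3 := by push_cast; ring
      _ ≤ (3 / 2) * ((n : ℝ) + 2) ^ 3 := key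
      _ ≤ (3 / 2) * (64 * (3 / 2 : ℝ) ^ n) := by gcongr
      _ = 64 * (3 / 2 : ℝ) ^ (n + 1) := by ring
  rcases Nat.lt_or_ge r 5 with hr | hr
  · interval_cases r <;> norm_num
  · induction r, hr using Nat.le_induction with
    | base => norm_num
    | succ n hn ih => exact step n hn ih

/-- Inner sums: if `‖f(i)‖ ≤ E(i+2)³ρ^i` with `0 ≤ ρ ≤ 1/2` then `Σ_i f(i)` converges absolutely with
norm `≤ 256E`. [folklore] -/
private theorem tsum_cubic_geom_bound {f : ℕ → ℂ} {E ρ : ℝ} (hE : 0 ≤ E) (hρ0 : 0 ≤ ρ)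
    (hρ : ρ ≤ 1 / 2) (hf : ∀ i : ℕ, ‖f i‖ ≤ E * ((i : ℝ) + 2) ^ 3 * ρ ^ i) :
    Summable f ∧ ‖∑' i : ℕ, f i‖ ≤ 256 * E := by
  have hterm : ∀ i : ℕ, ‖f i‖ ≤ 64 * E * (3 / 4 : ℝ) ^ i := fun i => by
    calc ‖f i‖ ≤ E * ((i : ℝ) + 2) ^ 3 * ρ ^ i := hf i
      _ ≤ E * (64 * (3 / 2 : ℝ) ^ i) * (1 / 2 : ℝ) ^ i := by
          gcongr
          exact pow_three_le' i
      _ = 64 * E * ((3 / 2 : ℝ) ^ i * (1 / 2) ^ i) := by ring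
      _ = 64 * E * (3 / 4 : ℝ) ^ i := by rw [← mul_pow]; norm_num
  have hgeo : HasSum (fun i : ℕ => 64 * E * (3 / 4 : ℝ) ^ i) (64 * E * 4) := by
    have h := (hasSum_geometric_of_lt_one (by norm_num : (0 : ℝ) ≤ 3 / 4) (by norm_num)).mul_left
      (64 * E)
    have e : 64 * E * (1 - 3 / 4 : ℝ)⁻¹ = 64 * E * 4 := by norm_num
    rwa [e] at h
  refine ⟨Summable.of_norm_bounded hgeo.summable hterm, ?_⟩
  calc ‖∑' i : ℕ, f i‖ ≤ 64 * E * 4 := tsum_of_norm_bounded hgeo hterm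
    _ = 256 * E := by ring

/-- Outer sums: if `‖Z‖ ≤ 3/5` and `‖f(r)‖ ≤ E(r+2)³` then `Σ_r Z^{r+1}f(r)` converges absolutely
with norm `≤ 640E‖Z‖`. [folklore] -/
private theorem tsum_pow_succ_mul_cubic_bound' {Z : ℂ} (hZ : ‖Z‖ ≤ 3 / 5) {f : ℕ → ℂ} {E : ℝ}
    (hE : 0 ≤ E) (hf : ∀ r : ℕ, ‖f r‖ ≤ E * ((r : ℝ) + 2) ^ 3) :
    Summable (fun r : ℕ => Z ^ (r + 1) * f r) ∧ ‖∑' r : ℕ, Z ^ (r + 1) * f r‖ ≤ 640 * E * ‖Z‖ := by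
  have hterm : ∀ r : ℕ, ‖Z ^ (r + 1) * f r‖ ≤ 64 * E * ‖Z‖ * (9 / 10 : ℝ) ^ r := fun r => by
    rw [norm_mul, norm_pow, pow_succ]
    have h1 : ‖Z‖ ^ r ≤ (3 / 5 : ℝ) ^ r := pow_le_pow_left₀ (norm_nonneg _) hZ r
    calc ‖Z‖ ^ r * ‖Z‖ * ‖f r‖ ≤ (3 / 5 : ℝ) ^ r * ‖Z‖ * (E * ((r : ℝ) + 2) ^ 3) := by
          gcongr; exact hf r
      _ ≤ (3 / 5 : ℝ) ^ r * ‖Z‖ * (E * (64 * (3 / 2 : ℝ) ^ r)) := by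
          gcongr; exact pow_three_le' r
      _ = 64 * E * ‖Z‖ * ((3 / 5 : ℝ) ^ r * (3 / 2) ^ r) := by ring
      _ = 64 * E * ‖Z‖ * (9 / 10 : ℝ) ^ r := by rw [← mul_pow]; norm_num
  have hgeo : HasSum (fun r : ℕ => 64 * E * ‖Z‖ * (9 / 10 : ℝ) ^ r) (64 * E * ‖Z‖ * 10) := by
    have h := (hasSum_geometric_of_lt_one (by norm_num : (0 : ℝ) ≤ 9 / 10) (by norm_num)).mul_left
      (64 * E * ‖Z‖)
    have e : 64 * E * ‖Z‖ * (1 - 9 / 10 : ℝ)⁻¹ = 64 * E * ‖Z‖ * 10 := by norm_num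
    rwa [e] at h
  refine ⟨Summable.of_norm_bounded hgeo.summable hterm, ?_⟩
  calc ‖∑' r : ℕ, Z ^ (r + 1) * f r‖ ≤ 64 * E * ‖Z‖ * 10 := tsum_of_norm_bounded hgeo hterm
    _ = 640 * E * ‖Z‖ := by ring

/-! ## The Case-1 inner sum at prime powers: uniform bounds -/

section Uniform

variable (c' : ℝ) (D : ℕ) (j : ℕ)

/-- `‖κ(q^m)/(q^i)^{1−β_j}‖ ≤ (m+1)³q^{−i}` (`|κ(q^m)| ≤ (m+1)³`, `|(q^i)^{1−β_j}| = q^i`).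
[cite: Zhang2022LandauSiegel, App. A p. 102] -/
theorem norm_kappaZ_div_cpow_le {q : ℕ} (hq : q.Prime) (m i : ℕ) :
    ‖kappaZ c' D (q ^ m) / ((q ^ i : ℕ) : ℂ) ^ (1 - betaJ c' D j)‖ ≤
      ((m : ℝ) + 1) ^ 3 * ((q : ℝ)⁻¹) ^ i := by
  have hqi : (0 : ℕ) < q ^ i := pow_pos hq.pos i
  have hden : ‖((q ^ i : ℕ) : ℂ) ^ (1 - betaJ c' D j)‖ = (q : ℝ) ^ i := by
    rw [Complex.norm_natCast_cpow_of_pos hqi, Complex.sub_re, Complex.one_re, Section8PerronSteps.betaJ_re, sub_zero,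
      Real.rpow_one]
    push_cast; ring
  have hκ : ‖kappaZ c' D (q ^ m)‖ ≤ ((m : ℝ) + 1) ^ 3 :=
    norm_kappa_prime_pow_le (b1 c' D) (b2 c' D) (b3 c' D) hq m
  have hqpos : (0 : ℝ) < q := by exact_mod_cast hq.pos
  have hq0 : (0 : ℝ) < (q : ℝ) ^ i := pow_pos hqpos i
  rw [norm_div, hden, div_le_iff₀ hq0]
  calc ‖kappaZ c' D (q ^ m)‖ ≤ ((m : ℝ) + 1) ^ 3 := hκ
    _ = ((m : ℝ) + 1) ^ 3 * ((q : ℝ)⁻¹) ^ i * (q : ℝ) ^ i := by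
        rw [inv_pow, mul_assoc, inv_mul_cancel₀ hq0.ne', mul_one]

/-- `‖κ(q^{n+i})/(q^i)^{1−β_j}‖ ≤ (n+1)³(i+2)³q^{−i}`. [cite: Zhang2022LandauSiegel, App. A p. 102] -/
theorem norm_case1_term_le {q : ℕ} (hq : q.Prime) (n i : ℕ) :
    ‖kappaZ c' D (q ^ (n + i)) / ((q ^ i : ℕ) : ℂ) ^ (1 - betaJ c' D j)‖ ≤
      ((n : ℝ) + 1) ^ 3 * ((i : ℝ) + 2) ^ 3 * ((q : ℝ)⁻¹) ^ i := by
  have h := norm_kappaZ_div_cpow_le c' D j hq (n + i) i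
  have hpoly : (((n + i : ℕ) : ℝ) + 1) ^ 3 ≤ ((n : ℝ) + 1) ^ 3 * ((i : ℝ) + 2) ^ 3 := by
    have hn0 : (0 : ℝ) ≤ n := Nat.cast_nonneg n
    have hi0 : (0 : ℝ) ≤ i := Nat.cast_nonneg i
    have h1 : ((n + i : ℕ) : ℝ) + 1 ≤ ((n : ℝ) + 1) * ((i : ℝ) + 2) := by push_cast; nlinarith
    calc (((n + i : ℕ) : ℝ) + 1) ^ 3 ≤ (((n : ℝ) + 1) * ((i : ℝ) + 2)) ^ 3 :=
          pow_le_pow_left₀ (by positivity) h1 3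
      _ = ((n : ℝ) + 1) ^ 3 * ((i : ℝ) + 2) ^ 3 := by ring
  have hρ : (0 : ℝ) ≤ ((q : ℝ)⁻¹) ^ i := by positivity
  exact le_trans h (mul_le_mul_of_nonneg_right hpoly hρ)

/-- The Case-1 series `Σ_i κ(q^{n+i})/(q^i)^{1−β_j}` converges absolutely with norm `≤ 256(n+1)³`,
uniformly in the prime `q`. [cite: Zhang2022LandauSiegel, App. A p. 102] -/
theorem summable_case1_series {q : ℕ} (hq : q.Prime) (n : ℕ) :
    Summable (fun i : ℕ => kappaZ c' D (q ^ (n + i)) / ((q ^ i : ℕ) : ℂ) ^ (1 - betaJ c' D j)) ∧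
      ‖∑' i : ℕ, kappaZ c' D (q ^ (n + i)) / ((q ^ i : ℕ) : ℂ) ^ (1 - betaJ c' D j)‖ ≤
        256 * ((n : ℝ) + 1) ^ 3 := by
  have hq2 : (2 : ℝ) ≤ q := by exact_mod_cast hq.two_le
  have hqinv : (q : ℝ)⁻¹ ≤ 1 / 2 := inv_le_of_inv_le₀ (by norm_num) (by linarith)
  exact tsum_cubic_geom_bound (E := ((n : ℝ) + 1) ^ 3) (ρ := (q : ℝ)⁻¹) (by positivity)
    (by positivity) hqinv (fun i => norm_case1_term_le c' D j hq n i)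

/-- `q^{1−β_j}/(q−1) = q^{−β_j}·(q/(q−1))`: norm `≤ 2`, within `2/q` of `q^{−β_j}`, and
`|q^{−β_j}| = 1`. [cite: Zhang2022LandauSiegel, App. A p. 102] -/
theorem cpow_one_sub_betaJ_div {q : ℕ} (hq : q.Prime) :
    ‖(q : ℂ) ^ (1 - betaJ c' D j) / ((q : ℂ) - 1)‖ ≤ 2 ∧
      ‖(q : ℂ) ^ (1 - betaJ c' D j) / ((q : ℂ) - 1) - (q : ℂ) ^ (-betaJ c' D j)‖ ≤ 2 / q ∧
      ‖(q : ℂ) ^ (-betaJ c' D j)‖ = 1 := by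
  have hq0 : (q : ℂ) ≠ 0 := by exact_mod_cast hq.ne_zero
  have hq2 : (2 : ℝ) ≤ q := by exact_mod_cast hq.two_le
  have hqpos : (0 : ℝ) < q := by linarith
  have hwn : ‖(q : ℂ) ^ (-betaJ c' D j)‖ = 1 := by
    rw [Complex.norm_natCast_cpow_of_pos hq.pos, Complex.neg_re, Section8PerronSteps.betaJ_re, neg_zero, Real.rpow_zero]
  have hq1n : (q : ℝ) - 1 ≤ ‖(q : ℂ) - 1‖ := by
    have h := norm_sub_norm_le (q : ℂ) 1
    rw [Complex.norm_natCast, norm_one] at h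
    exact h
  have hq1pos : (0 : ℝ) < (q : ℝ) - 1 := by linarith
  have hq1 : (q : ℂ) - 1 ≠ 0 := by
    intro h0; rw [h0, norm_zero] at hq1n; linarith
  have hsplit : (q : ℂ) ^ (1 - betaJ c' D j) = (q : ℂ) * (q : ℂ) ^ (-betaJ c' D j) := by
    rw [sub_eq_add_neg, Complex.cpow_add _ _ hq0, Complex.cpow_one]
  refine ⟨?_, ?_, hwn⟩
  · rw [hsplit, norm_div, norm_mul, hwn, mul_one, Complex.norm_natCast, div_le_iff₀ (by positivity)]
    nlinarith
  · have e : (q : ℂ) * (q : ℂ) ^ (-betaJ c' D j) / ((q : ℂ) - 1) - (q : ℂ) ^ (-betaJ c' D j) =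
        (q : ℂ) ^ (-betaJ c' D j) / ((q : ℂ) - 1) := by field_simp; ring
    rw [hsplit, e, norm_div, hwn, div_le_div_iff₀ (lt_of_lt_of_le hq1pos hq1n) hqpos]
    nlinarith

/-- The Case-1 inner sum in exact form, for EVERY prime `q ∤ dh` (no `q < D`):
`ξ_j(q^n;d,h) = Σ_i κ(q^{n+i})/(q^i)^{1−β_j} − κ(q^{n−1})q^{1−β_j}/(q−1)` (`n ≥ 1`).
[cite: Zhang2022LandauSiegel, App. A p. 102] -/
theorem xiA_prime_pow_eq {q : ℕ} (hq : q.Prime) {d h : ℕ} (hqd : ¬ q ∣ d) (hqh : ¬ q ∣ h) {n : ℕ}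
    (hn : 1 ≤ n) :
    xiA c' D j (q ^ n) d h =
      (∑' i : ℕ, kappaZ c' D (q ^ (n + i)) / ((q ^ i : ℕ) : ℂ) ^ (1 - betaJ c' D j)) -
        kappaZ c' D (q ^ (n - 1)) * (q : ℂ) ^ (1 - betaJ c' D j) / ((q : ℂ) - 1) := by
  unfold xiA
  rw [innerSum_prime_pow_of_not_dvd_right c' D j hq (by omega) hqh,
    kappaTildeZero_prime_pow_of_coprime c' D j hq (by omega) hqd hqh]

/-- **Uniform bound**: `‖ξ_j(q^n;d,h)‖ ≤ 258(n+1)³` for every prime `q ∤ dh` and `n ≥ 1`.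
[cite: Zhang2022LandauSiegel, App. A p. 102] -/
theorem norm_xiA_prime_pow_le {q : ℕ} (hq : q.Prime) {d h : ℕ} (hqd : ¬ q ∣ d) (hqh : ¬ q ∣ h)
    {n : ℕ} (hn : 1 ≤ n) : ‖xiA c' D j (q ^ n) d h‖ ≤ 258 * ((n : ℝ) + 1) ^ 3 := by
  rw [xiA_prime_pow_eq c' D j hq hqd hqh hn]
  obtain ⟨_, hS⟩ := summable_case1_series c' D j hq n
  obtain ⟨hfrac, _, _⟩ := cpow_one_sub_betaJ_div c' D j hq
  have hκ : ‖kappaZ c' D (q ^ (n - 1))‖ ≤ ((n : ℝ) + 1) ^ 3 := by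
    have h := norm_kappa_prime_pow_le (b1 c' D) (b2 c' D) (b3 c' D) hq (n - 1)
    refine le_trans h (pow_le_pow_left₀ (by positivity) ?_ 3)
    have : ((n - 1 : ℕ) : ℝ) ≤ n := by exact_mod_cast Nat.sub_le n 1
    linarith
  have hn0 : (0 : ℝ) ≤ ((n : ℝ) + 1) ^ 3 := by positivity
  calc _ ≤ ‖∑' i : ℕ, kappaZ c' D (q ^ (n + i)) / ((q ^ i : ℕ) : ℂ) ^ (1 - betaJ c' D j)‖ +
        ‖kappaZ c' D (q ^ (n - 1)) * (q : ℂ) ^ (1 - betaJ c' D j) / ((q : ℂ) - 1)‖ := norm_sub_le _ _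
    _ ≤ 256 * ((n : ℝ) + 1) ^ 3 + ((n : ℝ) + 1) ^ 3 * 2 := by
        rw [mul_div_assoc, norm_mul]
        exact add_le_add hS (mul_le_mul hκ hfrac (norm_nonneg _) hn0)
    _ = 258 * ((n : ℝ) + 1) ^ 3 := by ring

/-- **The generic term**: `‖ξ_j(q;d,h) − (κ(q) − q^{−β_j})‖ ≤ 866/q` for every prime `q ∤ dh`
(the `i ≥ 1` tail of the Case-1 series is `O(q⁻¹)` and `q^{1−β_j}/(q−1) = q^{−β_j} + O(q⁻¹)`).
[cite: Zhang2022LandauSiegel, App. A p. 101, tex L4993] -/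
theorem norm_xiA_prime_sub_le {q : ℕ} (hq : q.Prime) {d h : ℕ} (hqd : ¬ q ∣ d) (hqh : ¬ q ∣ h) :
    ‖xiA c' D j q d h - (kappaZ c' D q - (q : ℂ) ^ (-betaJ c' D j))‖ ≤ 866 / q := by
  have hq2 : (2 : ℝ) ≤ q := by exact_mod_cast hq.two_le
  have hqpos : (0 : ℝ) < q := by linarith
  have hqinv : (q : ℝ)⁻¹ ≤ 1 / 2 := inv_le_of_inv_le₀ (by norm_num) (by linarith)
  have hxi := xiA_prime_pow_eq c' D j hq hqd hqh (le_refl 1)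
  rw [pow_one] at hxi
  obtain ⟨hsum, _⟩ := summable_case1_series c' D j hq 1
  obtain ⟨_, hfrac, _⟩ := cpow_one_sub_betaJ_div c' D j hq
  -- the tail `Σ_i g(i+1)`, `g i = κ(q^{1+i})/(q^i)^{1−β_j}`
  set g : ℕ → ℂ := fun i => kappaZ c' D (q ^ (1 + i)) / ((q ^ i : ℕ) : ℂ) ^ (1 - betaJ c' D j)
    with hg
  have hg0 : g 0 = kappaZ c' D q := by
    simp [hg]
  have htail_term : ∀ i : ℕ, ‖g (i + 1)‖ ≤ 27 / 8 * (q : ℝ)⁻¹ * ((i : ℝ) + 2) ^ 3 * ((q : ℝ)⁻¹) ^ i := by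
    intro i
    have h := norm_kappaZ_div_cpow_le c' D j hq (1 + (i + 1)) (i + 1)
    have hpoly : (((1 + (i + 1) : ℕ) : ℝ) + 1) ^ 3 ≤ 27 / 8 * ((i : ℝ) + 2) ^ 3 := by
      have hi0 : (0 : ℝ) ≤ i := Nat.cast_nonneg i
      have h1 : ((1 + (i + 1) : ℕ) : ℝ) + 1 ≤ (3 / 2) * ((i : ℝ) + 2) := by push_cast; linarith
      calc (((1 + (i + 1) : ℕ) : ℝ) + 1) ^ 3 ≤ ((3 / 2) * ((i : ℝ) + 2)) ^ 3 :=
            pow_le_pow_left₀ (by positivity) h1 3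
        _ = 27 / 8 * ((i : ℝ) + 2) ^ 3 := by ring
    have hρ : (0 : ℝ) ≤ ((q : ℝ)⁻¹) ^ i := by positivity
    calc ‖g (i + 1)‖ ≤ (((1 + (i + 1) : ℕ) : ℝ) + 1) ^ 3 * ((q : ℝ)⁻¹) ^ (i + 1) := h
      _ ≤ 27 / 8 * ((i : ℝ) + 2) ^ 3 * ((q : ℝ)⁻¹) ^ (i + 1) := by gcongr
      _ = 27 / 8 * (q : ℝ)⁻¹ * ((i : ℝ) + 2) ^ 3 * ((q : ℝ)⁻¹) ^ i := by rw [pow_succ]; ring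
  obtain ⟨_, htail⟩ := tsum_cubic_geom_bound (f := fun i => g (i + 1)) (E := 27 / 8 * (q : ℝ)⁻¹)
    (ρ := (q : ℝ)⁻¹) (by positivity) (by positivity) hqinv htail_term
  have hsplit : (∑' i : ℕ, g i) = kappaZ c' D q + ∑' i : ℕ, g (i + 1) := by
    rw [hsum.tsum_eq_zero_add, hg0]
  have hκ0 : kappaZ c' D (q ^ (1 - 1)) = 1 := by rw [Nat.sub_self, pow_zero]; exact kappaZ_one c' D
  rw [hxi, hκ0, one_mul, hsplit]
  have e : kappaZ c' D q + (∑' i : ℕ, g (i + 1)) - (q : ℂ) ^ (1 - betaJ c' D j) / ((q : ℂ) - 1) -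
      (kappaZ c' D q - (q : ℂ) ^ (-betaJ c' D j)) =
      (∑' i : ℕ, g (i + 1)) - ((q : ℂ) ^ (1 - betaJ c' D j) / ((q : ℂ) - 1) - (q : ℂ) ^ (-betaJ c' D j)) := by
    ring
  rw [e]
  calc _ ≤ ‖∑' i : ℕ, g (i + 1)‖ +
        ‖(q : ℂ) ^ (1 - betaJ c' D j) / ((q : ℂ) - 1) - (q : ℂ) ^ (-betaJ c' D j)‖ := norm_sub_le _ _
    _ ≤ 256 * (27 / 8 * (q : ℝ)⁻¹) + 2 / q := add_le_add htail hfrac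
    _ = 866 / q := by rw [inv_eq_one_div]; ring

end Uniform

/-! ## `λ̃(q,dh;1−β_j)` at a prime `q ∤ dh`, and `κ(q) − q^{−β_j}` -/

section LamTilde

variable (c' : ℝ) (D : ℕ) (j : ℕ)

/-- For a prime `q` coprime to `k`, `λ̃(q,k;s)` is the single factor
`(1−q^{−s−β₁})(1−q^{−s−β₂})(1−q^{−s−β₃})/(1−q^{−s})`. [cite: Zhang2022LandauSiegel, App. A p. 101, tex L4980] -/
theorem lamTilde_prime_eq {q : ℕ} (hq : q.Prime) {k : ℕ} (hqk : Nat.Coprime q k) (s : ℂ) :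
    lamTilde c' D q k s =
      (1 - (q : ℂ) ^ (-(s + beta1 c' D))) * (1 - (q : ℂ) ^ (-(s + beta2 c' D))) *
        (1 - (q : ℂ) ^ (-(s + beta3 c' D))) / (1 - (q : ℂ) ^ (-s)) := by
  unfold lamTilde
  rw [hq.primeFactors, Finset.filter_singleton, if_pos hqk, Finset.prod_singleton]

/-- `‖(1−a)(1−b)(1−c)/(1−w)‖ ≤ 7` and `‖(1−a)(1−b)(1−c)/(1−w) − 1‖ ≤ 12u` when
`‖a‖, ‖b‖, ‖c‖, ‖w‖ ≤ u ≤ 1/2`. [folklore] -/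
private theorem norm_cubic_div_le {a b c w : ℂ} {u : ℝ} (hu : u ≤ 1 / 2) (ha : ‖a‖ ≤ u)
    (hb : ‖b‖ ≤ u) (hc : ‖c‖ ≤ u) (hw : ‖w‖ ≤ u) :
    ‖(1 - a) * (1 - b) * (1 - c) / (1 - w)‖ ≤ 7 ∧
      ‖(1 - a) * (1 - b) * (1 - c) / (1 - w) - 1‖ ≤ 12 * u := by
  have hu0 : 0 ≤ u := le_trans (norm_nonneg a) ha
  have hab : ‖a * b‖ ≤ u * u := by rw [norm_mul]; exact mul_le_mul ha hb (norm_nonneg _) hu0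
  have hbc : ‖b * c‖ ≤ u * u := by rw [norm_mul]; exact mul_le_mul hb hc (norm_nonneg _) hu0
  have hca : ‖c * a‖ ≤ u * u := by rw [norm_mul]; exact mul_le_mul hc ha (norm_nonneg _) hu0
  have habc : ‖a * b * c‖ ≤ u * u * u := by
    rw [norm_mul]; exact mul_le_mul hab hc (norm_nonneg _) (mul_nonneg hu0 hu0)
  have hN1 : ‖(1 - a) * (1 - b) * (1 - c) - 1‖ ≤ 19 / 4 * u := by
    have e : (1 - a) * (1 - b) * (1 - c) - 1 = (a * b + b * c + c * a) - (a + b + c) - a * b * c := by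
      ring
    rw [e]
    calc ‖(a * b + b * c + c * a) - (a + b + c) - a * b * c‖
        ≤ ‖(a * b + b * c + c * a) - (a + b + c)‖ + ‖a * b * c‖ := norm_sub_le _ _
      _ ≤ ‖a * b + b * c + c * a‖ + ‖a + b + c‖ + ‖a * b * c‖ := by
          gcongr; exact norm_sub_le _ _
      _ ≤ (u * u + u * u + u * u) + (u + u + u) + u * u * u := by
          gcongr
          · exact le_trans (norm_add₃_le) (by linarith)
          · exact le_trans (norm_add₃_le) (by linarith)
      _ ≤ 19 / 4 * u := by nlinarith
  have hden : 1 / 2 ≤ ‖1 - w‖ := by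
    have h := norm_sub_norm_le (1 : ℂ) w
    rw [norm_one] at h
    linarith
  have hden0 : 0 < ‖1 - w‖ := by linarith
  have h1w : 1 - w ≠ 0 := fun h0 => by rw [h0, norm_zero] at hden; linarith
  have hN : ‖(1 - a) * (1 - b) * (1 - c)‖ ≤ 1 + 19 / 4 * u := by
    have h := norm_le_norm_add_norm_sub' ((1 - a) * (1 - b) * (1 - c)) 1
    rw [norm_one] at h
    linarith
  refine ⟨?_, ?_⟩
  · rw [norm_div, div_le_iff₀ hden0]
    nlinarith
  · have e : (1 - a) * (1 - b) * (1 - c) / (1 - w) - 1 =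
        ((1 - a) * (1 - b) * (1 - c) - 1 + w) / (1 - w) := by
      field_simp; ring
    rw [e, norm_div, div_le_iff₀ hden0]
    calc ‖(1 - a) * (1 - b) * (1 - c) - 1 + w‖ ≤ ‖(1 - a) * (1 - b) * (1 - c) - 1‖ + ‖w‖ :=
          norm_add_le _ _
      _ ≤ 19 / 4 * u + u := add_le_add hN1 hw
      _ ≤ 12 * u * ‖1 - w‖ := by nlinarith

/-- At `s = 1 − β_j` and a prime `q ∤ k`: `‖λ̃(q,k;1−β_j)‖ ≤ 7` and `‖λ̃(q,k;1−β_j) − 1‖ ≤ 12/q`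
(every `q^{−(1−β_j+β_i)}` and `q^{−(1−β_j)}` has modulus `q⁻¹ ≤ 1/2`).
[cite: Zhang2022LandauSiegel, App. A p. 101] -/
theorem norm_lamTilde_prime_le {q : ℕ} (hq : q.Prime) {k : ℕ} (hqk : Nat.Coprime q k) :
    ‖lamTilde c' D q k (1 - betaJ c' D j)‖ ≤ 7 ∧
      ‖lamTilde c' D q k (1 - betaJ c' D j) - 1‖ ≤ 12 / q := by
  rw [lamTilde_prime_eq c' D hq hqk]
  have hq2 : (2 : ℝ) ≤ q := by exact_mod_cast hq.two_le
  have hqinv : (q : ℝ)⁻¹ ≤ 1 / 2 := inv_le_of_inv_le₀ (by norm_num) (by linarith)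
  have hre1 : (beta1 c' D).re = 0 := by unfold beta1; simp
  have hre2 : (beta2 c' D).re = 0 := by unfold beta2; simp
  have hre3 : (beta3 c' D).re = 0 := by unfold beta3; simp
  have hnorm : ∀ w : ℂ, w.re = -1 → ‖(q : ℂ) ^ w‖ ≤ (q : ℝ)⁻¹ := fun w hw => by
    rw [Complex.norm_natCast_cpow_of_pos hq.pos, hw, Real.rpow_neg_one]
  have h1 := hnorm (-(1 - betaJ c' D j + beta1 c' D)) (by simp [Section8PerronSteps.betaJ_re, hre1])
  have h2 := hnorm (-(1 - betaJ c' D j + beta2 c' D)) (by simp [Section8PerronSteps.betaJ_re, hre2])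
  have h3 := hnorm (-(1 - betaJ c' D j + beta3 c' D)) (by simp [Section8PerronSteps.betaJ_re, hre3])
  have h4 := hnorm (-(1 - betaJ c' D j)) (by simp [Section8PerronSteps.betaJ_re])
  obtain ⟨hA, hB⟩ := norm_cubic_div_le hqinv h1 h2 h3 h4
  exact ⟨hA, by rw [div_eq_mul_inv]; exact hB⟩

/-- The index bookkeeping `β₄ = β₁`, `β₅ = β₂`. [cite: Zhang2022LandauSiegel, §8 p. 17] -/
theorem betaJ_values :
    betaJ c' D 1 = beta1 c' D ∧ betaJ c' D 2 = beta2 c' D ∧ betaJ c' D 3 = beta3 c' D ∧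
      betaJ c' D 4 = beta1 c' D ∧ betaJ c' D 5 = beta2 c' D := by
  refine ⟨?_, ?_, ?_, ?_, ?_⟩ <;> simp [betaJ]

/-- **`κ(q) − q^{−β_j} = q^{−β_{j+1}} + q^{−β_{j+2}} − 1`** at a prime `q`, for `j ∈ {1,2,3}`
(`κ(q) = q^{−β₁} + q^{−β₂} + q^{−β₃} − 1`, indices mod 3). [cite: Zhang2022LandauSiegel, App. A p. 101, tex L4993] -/
theorem kappaZ_prime_sub_cpow {j : ℕ} (hj : j ∈ ({1, 2, 3} : Finset ℕ)) {q : ℕ} (hq : q.Prime) :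
    kappaZ c' D q - (q : ℂ) ^ (-betaJ c' D j) =
      (q : ℂ) ^ (-betaJ c' D (j + 1)) + (q : ℂ) ^ (-betaJ c' D (j + 2)) - 1 := by
  have hκ : kappaZ c' D q = powI (b1 c' D) q + powI (b2 c' D) q + powI (b3 c' D) q - 1 :=
    kappa_apply_prime _ _ _ hq
  obtain ⟨e1, e2, e3⟩ := cpow_neg_beta_eq_powI c' D hq.pos
  obtain ⟨h1, h2, h3, h4, h5⟩ := betaJ_values c' D
  rw [hκ, ← e1, ← e2, ← e3]
  simp only [Finset.mem_insert, Finset.mem_singleton] at hj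
  rcases hj with rfl | rfl | rfl
  · rw [h1, h2, h3]; ring
  · rw [h2, h3, h4]; ring
  · rw [h3, h4, h5]; ring

/-- **The generic-`q` estimate behind Z22:§A.u006** (χ-free core): for a prime `q ∤ dh` and
`j ∈ {1,2,3}`, `‖λ̃(q,dh;1−β_j)·ξ_j(q;d,h) − (q^{−β_{j+1}} + q^{−β_{j+2}} − 1)‖ ≤ 6100/q`.
[cite: Zhang2022LandauSiegel, App. A p. 101, tex L4993] -/
theorem norm_lamTilde_mul_xiA_prime_sub_le {j : ℕ} (hj : j ∈ ({1, 2, 3} : Finset ℕ)) {q : ℕ}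
    (hq : q.Prime) {d h : ℕ} (hqd : ¬ q ∣ d) (hqh : ¬ q ∣ h) :
    ‖lamTilde c' D q (d * h) (1 - betaJ c' D j) * xiA c' D j q d h -
        ((q : ℂ) ^ (-betaJ c' D (j + 1)) + (q : ℂ) ^ (-betaJ c' D (j + 2)) - 1)‖ ≤ 6100 / q := by
  have hqdh : Nat.Coprime q (d * h) :=
    (Nat.Prime.coprime_iff_not_dvd hq).mpr (fun h' => (hq.dvd_mul.mp h').elim hqd hqh)
  have hqpos : (0 : ℝ) < q := by exact_mod_cast hq.pos
  obtain ⟨hL, hL1⟩ := norm_lamTilde_prime_le c' D j hq hqdh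
  have hR := norm_xiA_prime_sub_le c' D j hq hqd hqh
  rw [kappaZ_prime_sub_cpow c' D hj hq] at hR
  set L : ℂ := lamTilde c' D q (d * h) (1 - betaJ c' D j)
  set M : ℂ := (q : ℂ) ^ (-betaJ c' D (j + 1)) + (q : ℂ) ^ (-betaJ c' D (j + 2)) - 1
  set ξ : ℂ := xiA c' D j q d h
  have hwn : ∀ k, ‖(q : ℂ) ^ (-betaJ c' D k)‖ = 1 := fun k => by
    rw [Complex.norm_natCast_cpow_of_pos hq.pos, Complex.neg_re, Section8PerronSteps.betaJ_re, neg_zero, Real.rpow_zero]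
  have hM : ‖M‖ ≤ 3 := by
    calc ‖M‖ ≤ ‖(q : ℂ) ^ (-betaJ c' D (j + 1)) + (q : ℂ) ^ (-betaJ c' D (j + 2))‖ + ‖(1 : ℂ)‖ :=
          norm_sub_le _ _
      _ ≤ ‖(q : ℂ) ^ (-betaJ c' D (j + 1))‖ + ‖(q : ℂ) ^ (-betaJ c' D (j + 2))‖ + ‖(1 : ℂ)‖ := by
          gcongr; exact norm_add_le _ _
      _ = 3 := by rw [hwn, hwn, norm_one]; norm_num
  have e : L * ξ - M = (L - 1) * M + L * (ξ - M) := by ring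
  rw [e]
  calc ‖(L - 1) * M + L * (ξ - M)‖ ≤ ‖L - 1‖ * ‖M‖ + ‖L‖ * ‖ξ - M‖ := by
        rw [← norm_mul, ← norm_mul]; exact norm_add_le _ _
    _ ≤ 12 / q * 3 + 7 * (866 / q) :=
        add_le_add (mul_le_mul hL1 hM (norm_nonneg _) (by positivity))
          (mul_le_mul hL hR (norm_nonneg _) (by norm_num))
    _ = 6098 / q := by ring
    _ ≤ 6100 / q := by gcongr; norm_num

/-- **Z22:§A.u006 in the instance used holds** (App. A p. 101, tex L4993; flag F3 of
`TypedAppendixA1`: `r = 1`, `(q,dh) = 1`): for every prime `q` with `(q,dh) = 1`,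
`‖λ̃(q,dh;1−β_j)χ(q)ξ_j(q;d,h) − χ(q)(q^{−β_{j+1}} + q^{−β_{j+2}} − 1)‖ ≤ 6100/q` — for every `D`
and every Dirichlet character (no largeness, no Assumption (A) used). [cite: Zhang2022LandauSiegel, App. A p. 101, tex L4993] -/
theorem stepA_u006_used_holds (c' : ℝ) : StepA_u006_used c' := by
  refine ⟨6100, 0, fun D _ χ _ _ _ _ j hj d h _ _ _ q hq hcop => ?_⟩
  have hqd : ¬ q ∣ d := fun h' => ((Nat.Prime.coprime_iff_not_dvd hq).mp hcop) (dvd_mul_of_dvd_left h' h)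
  have hqh : ¬ q ∣ h := fun h' => ((Nat.Prime.coprime_iff_not_dvd hq).mp hcop) (dvd_mul_of_dvd_right h' d)
  have key := norm_lamTilde_mul_xiA_prime_sub_le c' D hj hq hqd hqh
  have e : lamTilde c' D q (d * h) (1 - betaJ c' D j) * χ (q : ZMod D) * xiA c' D j q d h -
      χ (q : ZMod D) *
        ((q : ℂ) ^ (-betaJ c' D (j + 1)) + (q : ℂ) ^ (-betaJ c' D (j + 2)) - 1) =
      χ (q : ZMod D) * (lamTilde c' D q (d * h) (1 - betaJ c' D j) * xiA c' D j q d h -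
        ((q : ℂ) ^ (-betaJ c' D (j + 1)) + (q : ℂ) ^ (-betaJ c' D (j + 2)) - 1)) := by ring
  rw [e, norm_mul]
  calc _ ≤ 1 * (6100 / (q : ℝ)) := mul_le_mul (χ.norm_le_one _) key (norm_nonneg _) zero_le_one
    _ = 6100 / q := one_mul _

variable (c' : ℝ) in
/-- `StepA_u006_used` — `_holds` alias of `stepA_u006_used_holds` above under the fact's exact name, stated under the
prover's own binders as section variables (appended 2026-08-28, D-0026 bookkeeping: the proof term is the
existing theorem of this file; no statement, definition or attribute is edited; no new named fact; the
ledger's debt table listed the fact unproved). [cite: Zhang2022LandauSiegel, App. A p. 101, tex L4993] -/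
theorem _root_.Literature.NumberTheory.LFunctions.Zhang2022.Typed.AppendixA1.StepA_u006_used_holds :
    _root_.Literature.NumberTheory.LFunctions.Zhang2022.Typed.AppendixA1.StepA_u006_used c' :=
  _root_.Literature.NumberTheory.LFunctions.Zhang2022.Lemma83.stepA_u006_used_holds (c' := c')

end LamTilde

/-! ## `𝔱_j(d,h,s;q) = 1 + O(q^{−9/5})` for `σ > 9/10`, `(q,dh) = 1` (Z22:§A.u007, local clause) -/

section LocalT

variable (c' : ℝ)

/-- `2^{−9/10} ≤ 3/5` (since `(5/3)^{10} < 2^9`). [folklore] -/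
private theorem two_rpow_neg_nine_tenths_le : (2 : ℝ) ^ (-(9 / 10 : ℝ)) ≤ 3 / 5 := by
  have hpow : ((2 : ℝ) ^ ((9 : ℝ) / 10)) ^ (10 : ℕ) = 2 ^ (9 : ℕ) := by
    rw [← Real.rpow_natCast, ← Real.rpow_mul (by norm_num)]
    norm_num
  have hge : (5 : ℝ) / 3 ≤ (2 : ℝ) ^ ((9 : ℝ) / 10) := by
    by_contra hlt
    rw [not_le] at hlt
    have h10 : ((2 : ℝ) ^ ((9 : ℝ) / 10)) ^ (10 : ℕ) < ((5 : ℝ) / 3) ^ (10 : ℕ) :=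
      pow_lt_pow_left₀ hlt (by positivity) (by norm_num)
    rw [hpow] at h10
    norm_num at h10
  have hpos : (0 : ℝ) < (2 : ℝ) ^ ((9 : ℝ) / 10) := by positivity
  rw [show (-(9 / 10 : ℝ)) = -((9 : ℝ) / 10) by ring, Real.rpow_neg (by norm_num)]
  calc ((2 : ℝ) ^ ((9 : ℝ) / 10))⁻¹ ≤ ((5 : ℝ) / 3)⁻¹ := by
        exact inv_anti₀ (by norm_num) hge
    _ = 3 / 5 := by norm_num

/-- Size bookkeeping for `X = q^{−s}`, `σ > 9/10`, `q ≥ 2`: with `x = ‖X‖ = q^{−σ}` one has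
`x ≤ 3/5`, `x² ≤ q^{−9/5}` and `x/q ≤ q^{−9/5}`. [folklore] -/
private theorem frame_sigma {q : ℕ} (hq : q.Prime) {s : ℂ} (hs : 9 / 10 < s.re) :
    ‖(q : ℂ) ^ (-s)‖ ≤ 3 / 5 ∧ ‖(q : ℂ) ^ (-s)‖ ^ 2 ≤ (q : ℝ) ^ (-(9 / 5 : ℝ)) ∧
      ‖(q : ℂ) ^ (-s)‖ / q ≤ (q : ℝ) ^ (-(9 / 5 : ℝ)) ∧ 0 ≤ ‖(q : ℂ) ^ (-s)‖ := by
  have hq2 : (2 : ℝ) ≤ q := by exact_mod_cast hq.two_le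
  have hq1 : (1 : ℝ) ≤ q := by linarith
  have hqpos : (0 : ℝ) < q := by linarith
  have hx : ‖(q : ℂ) ^ (-s)‖ = (q : ℝ) ^ (-s.re) := by
    rw [Complex.norm_natCast_cpow_of_pos hq.pos, Complex.neg_re]
  have hx1 : (q : ℝ) ^ (-s.re) ≤ (q : ℝ) ^ (-(9 / 10 : ℝ)) :=
    Real.rpow_le_rpow_of_exponent_le hq1 (by linarith)
  have hx2 : (q : ℝ) ^ (-(9 / 10 : ℝ)) ≤ (2 : ℝ) ^ (-(9 / 10 : ℝ)) :=
    Real.rpow_le_rpow_of_nonpos (by norm_num) hq2 (by norm_num)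
  have hxnn : 0 ≤ (q : ℝ) ^ (-s.re) := Real.rpow_nonneg hqpos.le _
  rw [hx]
  refine ⟨le_trans hx1 (le_trans hx2 two_rpow_neg_nine_tenths_le), ?_, ?_, hxnn⟩
  · have h9 : (q : ℝ) ^ (-(9 / 10 : ℝ)) * (q : ℝ) ^ (-(9 / 10 : ℝ)) = (q : ℝ) ^ (-(9 / 5 : ℝ)) := by
      rw [← Real.rpow_add hqpos]; norm_num
    calc ((q : ℝ) ^ (-s.re)) ^ 2 = (q : ℝ) ^ (-s.re) * (q : ℝ) ^ (-s.re) := sq _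
      _ ≤ (q : ℝ) ^ (-(9 / 10 : ℝ)) * (q : ℝ) ^ (-(9 / 10 : ℝ)) :=
          mul_le_mul hx1 hx1 hxnn (Real.rpow_nonneg hqpos.le _)
      _ = (q : ℝ) ^ (-(9 / 5 : ℝ)) := h9
  · have hq' : (q : ℝ)⁻¹ = (q : ℝ) ^ (-(1 : ℝ)) := (Real.rpow_neg_one (q : ℝ)).symm
    have h19 : (q : ℝ) ^ (-(9 / 10 : ℝ)) * (q : ℝ) ^ (-(1 : ℝ)) = (q : ℝ) ^ (-(19 / 10 : ℝ)) := by
      rw [← Real.rpow_add hqpos]; norm_num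
    calc (q : ℝ) ^ (-s.re) / q = (q : ℝ) ^ (-s.re) * (q : ℝ) ^ (-(1 : ℝ)) := by
          rw [div_eq_mul_inv, hq']
      _ ≤ (q : ℝ) ^ (-(9 / 10 : ℝ)) * (q : ℝ) ^ (-(1 : ℝ)) :=
          mul_le_mul_of_nonneg_right hx1 (Real.rpow_nonneg hqpos.le _)
      _ = (q : ℝ) ^ (-(19 / 10 : ℝ)) := h19
      _ ≤ (q : ℝ) ^ (-(9 / 5 : ℝ)) := Real.rpow_le_rpow_of_exponent_le hq1 (by norm_num)

/-- **The local clause of Z22:§A.u007** (App. A p. 101, tex L4999: "we have `𝔱_j(d,h,s;q) =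
1 + O(q^{−9/5})` for `σ > 9/10`"): for a prime `q ∤ dh`, `j ∈ {1,2,3}` and `σ > 9/10`,
`‖𝔱_j(d,h,s;q) − 1‖ ≤ 26·10⁶·q^{−9/5}`, for every `D` and every Dirichlet character. With
`Z = χ(q)q^{−s}`, `a = q^{−β_{j+1}}`, `b = q^{−β_{j+2}}`, `M = a + b − 1`, `L = λ̃(q,dh;1−β_j)` and
`Σ_r χ(q^r)ξ_j(q^r)q^{−rs} = Zξ_j(q) + Z·T′`, the exact identity
`𝔱_j − 1 = Z²(ab + M(Zab − a − b))/(1−Z) + pref·Z·(Lξ_j(q) − M) + pref·L·Z·T′` exhibits the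
cancellation of the first-order terms. [cite: Zhang2022LandauSiegel, App. A p. 101, tex L4999] -/
theorem norm_frakt_sub_one_le {D : ℕ} (χ : DirichletCharacter ℂ D) {j : ℕ}
    (hj : j ∈ ({1, 2, 3} : Finset ℕ)) {q : ℕ} (hq : q.Prime) {d h : ℕ} (hqd : ¬ q ∣ d)
    (hqh : ¬ q ∣ h) {s : ℂ} (hs : 9 / 10 < s.re) :
    ‖frakt c' χ j d h s q - 1‖ ≤ 26000000 * (q : ℝ) ^ (-(9 / 5 : ℝ)) := by
  have hq0 : (q : ℂ) ≠ 0 := by exact_mod_cast hq.ne_zero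
  have hqpos : (0 : ℝ) < q := by exact_mod_cast hq.pos
  have hqdh : Nat.Coprime q (d * h) :=
    (Nat.Prime.coprime_iff_not_dvd hq).mpr (fun h' => (hq.dvd_mul.mp h').elim hqd hqh)
  obtain ⟨hx35, hx2, hxq, hx0⟩ := frame_sigma hq hs
  -- notation
  set X : ℂ := (q : ℂ) ^ (-s) with hXdef
  set v : ℂ := χ (q : ZMod D) with hvdef
  set Z : ℂ := v * X with hZdef
  set a : ℂ := (q : ℂ) ^ (-betaJ c' D (j + 1)) with hadef
  set b : ℂ := (q : ℂ) ^ (-betaJ c' D (j + 2)) with hbdef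
  set L : ℂ := lamTilde c' D q (d * h) (1 - betaJ c' D j) with hLdef
  set M : ℂ := a + b - 1 with hMdef
  set ξ : ℕ → ℂ := fun n => xiA c' D j (q ^ n) d h with hξdef
  set x : ℝ := ‖X‖ with hxdef
  -- sizes
  have hv1 : ‖v‖ ≤ 1 := χ.norm_le_one _
  have hZx : ‖Z‖ ≤ x := by
    rw [hZdef, norm_mul]
    calc ‖v‖ * ‖X‖ ≤ 1 * ‖X‖ := mul_le_mul_of_nonneg_right hv1 (norm_nonneg _)
      _ = x := one_mul _
  have hZ35 : ‖Z‖ ≤ 3 / 5 := le_trans hZx hx35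
  have hwn : ∀ k, ‖(q : ℂ) ^ (-betaJ c' D k)‖ = 1 := fun k => by
    rw [Complex.norm_natCast_cpow_of_pos hq.pos, Complex.neg_re, Section8PerronSteps.betaJ_re,
      neg_zero, Real.rpow_zero]
  have ha1 : ‖a‖ = 1 := hwn (j + 1)
  have hb1 : ‖b‖ = 1 := hwn (j + 2)
  have hM3 : ‖M‖ ≤ 3 := by
    calc ‖M‖ ≤ ‖a + b‖ + ‖(1 : ℂ)‖ := norm_sub_le _ _
      _ ≤ ‖a‖ + ‖b‖ + ‖(1 : ℂ)‖ := by gcongr; exact norm_add_le _ _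
      _ = 3 := by rw [ha1, hb1, norm_one]; norm_num
  obtain ⟨hL7, _⟩ := norm_lamTilde_prime_le c' D j hq hqdh
  have hden : 2 / 5 ≤ ‖1 - Z‖ := by
    have h := norm_sub_norm_le (1 : ℂ) Z
    rw [norm_one] at h
    linarith
  have hden0 : 0 < ‖1 - Z‖ := by linarith
  have h1Z : 1 - Z ≠ 0 := fun h0 => by rw [h0, norm_zero] at hden; linarith
  -- the prefactor
  have hpref : pref c' χ j s q = (1 - Z * a) * (1 - Z * b) / (1 - Z) := by
    rw [pref, neg_add, Complex.cpow_add _ _ hq0, neg_add, Complex.cpow_add _ _ hq0]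
    simp only [hZdef, hvdef, hXdef, hadef, hbdef]
    ring
  have hprefn : ‖pref c' χ j s q‖ ≤ 32 / 5 := by
    rw [hpref, norm_div, div_le_iff₀ hden0, norm_mul]
    have h1 : ‖1 - Z * a‖ ≤ 8 / 5 := by
      calc ‖1 - Z * a‖ ≤ ‖(1 : ℂ)‖ + ‖Z * a‖ := norm_sub_le _ _
        _ ≤ 1 + 3 / 5 := by rw [norm_one, norm_mul, ha1, mul_one]; gcongr
        _ = 8 / 5 := by norm_num
    have h2 : ‖1 - Z * b‖ ≤ 8 / 5 := by
      calc ‖1 - Z * b‖ ≤ ‖(1 : ℂ)‖ + ‖Z * b‖ := norm_sub_le _ _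
        _ ≤ 1 + 3 / 5 := by rw [norm_one, norm_mul, hb1, mul_one]; gcongr
        _ = 8 / 5 := by norm_num
    nlinarith [norm_nonneg (1 - Z * a), norm_nonneg (1 - Z * b), mul_le_mul h1 h2 (norm_nonneg _) (by norm_num)]
  -- the series `Σ_r Z^{r+1} ξ(r+1) = Z ξ(1) + Z·T'`
  have hS : xiPowSum c' χ j d h s q = ∑' r : ℕ, Z ^ (r + 1) * ξ (r + 1) := xiPowSum_eq c' χ j d h s hq.pos
  have hξb : ∀ r : ℕ, ‖ξ (r + 1)‖ ≤ 258 * ((r : ℝ) + 2) ^ 3 := fun r => by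
    have h := norm_xiA_prime_pow_le c' D j hq hqd hqh (n := r + 1) (by omega)
    have e : (((r + 1 : ℕ) : ℝ) + 1) = (r : ℝ) + 2 := by push_cast; ring
    rw [e] at h; exact h
  have hξb2 : ∀ r : ℕ, ‖ξ (r + 2)‖ ≤ 871 * ((r : ℝ) + 2) ^ 3 := fun r => by
    have h := norm_xiA_prime_pow_le c' D j hq hqd hqh (n := r + 2) (by omega)
    have hr0 : (0 : ℝ) ≤ r := Nat.cast_nonneg r
    have e : (((r + 2 : ℕ) : ℝ) + 1) = (r : ℝ) + 3 := by push_cast; ring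
    rw [e] at h
    have hpoly : ((r : ℝ) + 3) ^ 3 ≤ 27 / 8 * ((r : ℝ) + 2) ^ 3 := by
      have h1 : (r : ℝ) + 3 ≤ (3 / 2) * ((r : ℝ) + 2) := by linarith
      calc ((r : ℝ) + 3) ^ 3 ≤ ((3 / 2) * ((r : ℝ) + 2)) ^ 3 := pow_le_pow_left₀ (by positivity) h1 3
        _ = 27 / 8 * ((r : ℝ) + 2) ^ 3 := by ring
    calc ‖ξ (r + 2)‖ ≤ 258 * ((r : ℝ) + 3) ^ 3 := h
      _ ≤ 258 * (27 / 8 * ((r : ℝ) + 2) ^ 3) := by gcongr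
      _ ≤ 871 * ((r : ℝ) + 2) ^ 3 := by nlinarith [pow_nonneg (show (0:ℝ) ≤ (r : ℝ) + 2 by positivity) 3]
  obtain ⟨hsum1, _⟩ := tsum_pow_succ_mul_cubic_bound' hZ35 (f := fun r => ξ (r + 1)) (E := 258)
    (by norm_num) hξb
  obtain ⟨_, hT'⟩ := tsum_pow_succ_mul_cubic_bound' hZ35 (f := fun r => ξ (r + 2)) (E := 871)
    (by norm_num) hξb2
  set T' : ℂ := ∑' r : ℕ, Z ^ (r + 1) * ξ (r + 2) with hT'def
  have hsplit : (∑' r : ℕ, Z ^ (r + 1) * ξ (r + 1)) = Z * ξ 1 + Z * T' := by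
    rw [hsum1.tsum_eq_zero_add]
    have e2 : (fun r : ℕ => Z ^ (r + 1 + 1) * ξ (r + 1 + 1)) = fun r : ℕ => Z * (Z ^ (r + 1) * ξ (r + 2)) := by
      funext r
      rw [show r + 1 + 1 = r + 2 by ring, pow_succ]
      ring
    rw [e2, tsum_mul_left, zero_add, pow_one]
  -- the `r = 1` term: `L ξ(1) = M + O(1/q)`
  have hcore := norm_lamTilde_mul_xiA_prime_sub_le c' D hj hq hqd hqh
  have hξ1 : ξ 1 = xiA c' D j q d h := by simp [hξdef]
  -- the exact identity
  have hfrakt : frakt c' χ j d h s q = pref c' χ j s q * (1 + L * (Z * ξ 1 + Z * T')) := by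
    rw [frakt, hS, hsplit]
  have hid : frakt c' χ j d h s q - 1 =
      Z ^ 2 * (a * b + M * (Z * a * b - (a + b))) / (1 - Z) +
        pref c' χ j s q * Z * (L * ξ 1 - M) + pref c' χ j s q * L * (Z * T') := by
    rw [hfrakt, hpref, hMdef]
    field_simp
    ring
  rw [hid]
  -- bounds
  have hT1 : ‖Z ^ 2 * (a * b + M * (Z * a * b - (a + b))) / (1 - Z)‖ ≤ 22 * x ^ 2 := by
    rw [norm_div, div_le_iff₀ hden0, norm_mul, norm_pow]
    have hin : ‖a * b + M * (Z * a * b - (a + b))‖ ≤ 44 / 5 := by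
      calc ‖a * b + M * (Z * a * b - (a + b))‖ ≤ ‖a * b‖ + ‖M * (Z * a * b - (a + b))‖ := norm_add_le _ _
        _ ≤ 1 + 3 * (13 / 5) := by
            rw [norm_mul, norm_mul, ha1, hb1, mul_one]
            refine add_le_add (le_refl _) (mul_le_mul hM3 ?_ (norm_nonneg _) (by norm_num))
            calc ‖Z * a * b - (a + b)‖ ≤ ‖Z * a * b‖ + ‖a + b‖ := norm_sub_le _ _
              _ ≤ 3 / 5 + (1 + 1) := by
                  rw [norm_mul, norm_mul, ha1, hb1, mul_one, mul_one]
                  exact add_le_add hZ35 (le_trans (norm_add_le _ _) (by rw [ha1, hb1]))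
              _ = 13 / 5 := by norm_num
        _ = 44 / 5 := by norm_num
    have hZ2 : ‖Z‖ ^ 2 ≤ x ^ 2 := pow_le_pow_left₀ (norm_nonneg _) hZx 2
    nlinarith [norm_nonneg (a * b + M * (Z * a * b - (a + b))), sq_nonneg x, sq_nonneg ‖Z‖,
      mul_le_mul hZ2 hin (norm_nonneg _) (sq_nonneg x)]
  have hT2 : ‖pref c' χ j s q * Z * (L * ξ 1 - M)‖ ≤ 32 / 5 * x * (6100 / q) := by
    rw [norm_mul, norm_mul, hξ1]
    exact mul_le_mul (mul_le_mul hprefn hZx (norm_nonneg _) (by norm_num)) hcore (norm_nonneg _)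
      (by positivity)
  have hT3 : ‖pref c' χ j s q * L * (Z * T')‖ ≤ 32 / 5 * 7 * (x * (640 * 871 * x)) := by
    rw [norm_mul, norm_mul, norm_mul]
    refine mul_le_mul (mul_le_mul hprefn hL7 (norm_nonneg _) (by norm_num)) ?_ (by positivity)
      (by positivity)
    exact mul_le_mul hZx (le_trans hT' (by nlinarith)) (norm_nonneg _) hx0
  calc _ ≤ ‖Z ^ 2 * (a * b + M * (Z * a * b - (a + b))) / (1 - Z) +
          pref c' χ j s q * Z * (L * ξ 1 - M)‖ + ‖pref c' χ j s q * L * (Z * T')‖ := norm_add_le _ _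
    _ ≤ (22 * x ^ 2 + 32 / 5 * x * (6100 / q)) + 32 / 5 * 7 * (x * (640 * 871 * x)) := by
        gcongr
        exact le_trans (norm_add_le _ _) (add_le_add hT1 hT2)
    _ = (22 + 32 / 5 * 7 * 640 * 871) * x ^ 2 + 32 / 5 * 6100 * (x / q) := by ring
    _ ≤ (22 + 32 / 5 * 7 * 640 * 871) * (q : ℝ) ^ (-(9 / 5 : ℝ)) +
          32 / 5 * 6100 * (q : ℝ) ^ (-(9 / 5 : ℝ)) := by
        gcongr
    _ ≤ 26000000 * (q : ℝ) ^ (-(9 / 5 : ℝ)) := by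
        have h0 : 0 ≤ (q : ℝ) ^ (-(9 / 5 : ℝ)) := Real.rpow_nonneg hqpos.le _
        nlinarith

/-- **The local clause of Z22:§A.u007 holds** (`Typed.AppendixA1.StepA_u007_local`, App. A
p. 101, tex L4999): for every prime `q` with `(q,dh) = 1` and `σ > 9/10`,
`‖𝔱_j(d,h,s;q) − 1‖ ≤ 26·10⁶·q^{−9/5}` — for every `D` and every Dirichlet character (no
largeness, no Assumption (A) used). [cite: Zhang2022LandauSiegel, App. A p. 101, tex L4999] -/
theorem stepA_u007_local_holds (c' : ℝ) : StepA_u007_local c' := by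
  refine ⟨26000000, 0, fun D _ χ _ _ _ _ j hj d h _ _ _ q hq hcop s hs => ?_⟩
  have hqd : ¬ q ∣ d := fun h' => ((Nat.Prime.coprime_iff_not_dvd hq).mp hcop) (dvd_mul_of_dvd_left h' h)
  have hqh : ¬ q ∣ h := fun h' => ((Nat.Prime.coprime_iff_not_dvd hq).mp hcop) (dvd_mul_of_dvd_right h' d)
  exact norm_frakt_sub_one_le c' χ hj hq hqd hqh hs

variable (c' : ℝ) in
/-- `StepA_u007_local` — `_holds` alias of `stepA_u007_local_holds` above under the fact's exact name, stated under the
prover's own binders as section variables (appended 2026-08-28, D-0026 bookkeeping: the proof term is the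
existing theorem of this file; no statement, definition or attribute is edited; no new named fact; the
ledger's debt table listed the fact unproved). [cite: Zhang2022LandauSiegel, App. A p. 101, tex L4999] -/
theorem _root_.Literature.NumberTheory.LFunctions.Zhang2022.Typed.AppendixA1.StepA_u007_local_holds :
    _root_.Literature.NumberTheory.LFunctions.Zhang2022.Typed.AppendixA1.StepA_u007_local c' :=
  _root_.Literature.NumberTheory.LFunctions.Zhang2022.Lemma83.stepA_u007_local_holds (c' := c')

end LocalT




end Literature.NumberTheory.LFunctions.Zhang2022.Lemma83
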